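import Summits.QuantumFields.BalabanUV.Beta.HessKerSlotCurrencyRowD1
import Summits.QuantumFields.BalabanUV.Beta.RowD1TelescopingBounded

/-!
# `BalabanUV.Beta.RowD1ThreeRoads` — binder row D1: THE THREE OPEN CLAUSES OF THE THREE ROADS IN ONE KERNEL STATEMENT —
# (SDF-Σ) (telescoping, LAYER 2), `D1Rep(JcPin)` (large-block first step, road BF-x ∕ G-an2-4) and road A2's IDENTIFICATION
# «limit W-half + limit S-half second moment = stepBal» (fixed point, asym1's L2 half-kernel letters): GIVEN road A2's letters, ANY TWO GIVE THE THIRD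
# (β sub-cell, BINDER-OWNERS row D1 OWNER, lineage an2 gen 22; composition BY NAME of asym1's `HessKerSlotCurrencyRowD1` and the owner's `RowD1TelescopingBounded`)

HONEST FRAMING (cell charter, verbatim): «discharging BetaPertH makes Balaban's UV stability UNCONDITIONAL — a real
constructive-QFT result; it is NOT the continuum limit and NOT the Clay problem.»
HONEST DEPENDENCY: continuum YM on T⁴ ⇐ BetaPertH ∧ nine spine estimates (0/9 proved); BetaPertH ⇐ (D1) ∧ (D4) ∧ CAP+tail;
G-an2-4 gates asym, D1 and NE2/3/4.
ABSOLUTE RULE (cell, verbatim): «No internally-minted statement may enter as a cited fact. Every hypothesis is either kernel-proved in this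
package or a verbatim quotation of a PUBLISHED theorem with page reference. The manuscript(s) under audit are NOT citable for their own
disputed steps — they are the thing under adjudication; programme-internal (2001/route/tribunal) claims are never citable.»
NOTHING below is cited; no `def`, no `Prop`.  [folklore] composition BY NAME: asym1-g52's `HessKerSlotCurrencyRowD1.d1Drift_JsRowD1_iff_of_halfKernel_letters`
(p233873, courier lit1-g31; ruling R-asym1-g52-1, owner's GO R-D1-g22-6) at the pins of the literal of record (`JsRowD1Pin hLc N = JsRowD1 hLc N (2∕Lc⁴) (−Lc¹²∕4)`,
`RowD1JointEnd.JsRowD1Pin_eq`, `rfl`) and the owner's `RowD1TelescopingBounded` «two out of three» (p232615∕p233363).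

WHY (row-D1 owner, gen 22).  After tonight the row has three OPEN clauses, one per road, each a closed predicate over the typed literal:
(T) the telescoping clause (SDF-Σ) `∃ U′, ∀ m ≥ 1, |Σ_{j ∈ [1,m)} secondMoment (SD Lc (JsRowD1Pin hLc N) (JcPin hLc N) j) μ ν| ≤ U′` (LAYER 2 of P6 + P6c, `O(1)`-tolerant);
(R) `D1Rep Lc (JcPin hLc N) Nc μ ν a SL k` (EXIT-A: the large-block asymptotics of the once-dressed first step, road BF-x ∕ G-an2-4);
(I) road A2's IDENTIFICATION `secondMoment (limKernelOf W-half) μ ν + secondMoment (limKernelOf S-half) μ ν = stepBal Nc Lc` at the constructed limits of the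
unit-free half kernels of the literal (asym1's O-asym1-7; GIVEN the four L2 half-kernel letters it is EQUIVALENT to `D1Drift`).
This file records, in the kernel, that GIVEN road A2's four letters (HYPOTHESES) and the free-bubble drift's standing data, ANY TWO OF (T), (R), (I) GIVE
THE THIRD — so the referee's countdown can book a landing on any road against the other two.  Nothing is discharged.

WHAT (all [folklore]; `Odd Lc`, `2 ≤ Lc`, `2 ≤ N`; letters on the W-half `j ↦ hessKer G_j 0 W⁰_j` and the S-half `j ↦ hessKer G_j (vertexOfK G_j Lc S⁰_j) 0` of
the literal, `G_j = coDressKBmAt ρ_c Lc (KInvStep Lc j)`, `(S⁰_j, W⁰_j)` = `FP.RoadRowD1.JsRowD1Undressed hLc N (2∕Lc⁴) (−Lc¹²∕4) j`):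
* `ident_of_sdSumBdd_D1Rep` : (T) ∧ (R) ⟹ (I);  * `sdSumBdd_of_ident_D1Rep` : (I) ∧ (R) ⟹ (T);  * `d1Rep_of_ident_sdSumBdd` : (I) ∧ (T) ⟹ (R);
* `sdSumBdd_iff_ident_of_D1Rep` : GIVEN (R), (T) ⟺ (I).
Binders 2∕4; (T), (R), (I) OPEN; NOT D1, NOT `BetaPertH`, NOT continuum, NOT Clay.  Provenance: β sub-cell, unit beta-an2 gen 22, 2026-08-20 (v1); no existing file touched.
-/

open Finset
open scoped BigOperators
open Literature.MathematicalPhysics.QuantumFieldTheory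
open Literature.MathematicalPhysics.QuantumFieldTheory.Balaban1983to89
open Literature.MathematicalPhysics.QuantumFieldTheory.Balaban1983to89.Beta
open B12Beta (secondMoment)
open B12Normalization (stepBal)
open ExpKernelCalculus (hessKer)
open LimitRate (UniformDecay limKernelOf)
open HessKerSchurCauchy (AllScalesRate)
open OneStepResolventKernel (JetData)
open OneStepKernelFamily (vertexOfK KInvStep TbalOf TshotOf D1Rep D1Drift)
open StepDriftWitness (SD)
open AffineAveraging (toSite)
open AveragingContoursRooted (ctrOff)
open Literature.MathematicalPhysics.QuantumFieldTheory.Balaban1983to89.Beta.VectorTailsLoc (fam kfam)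
open Literature.MathematicalPhysics.QuantumFieldTheory.Balaban1983to89.Beta.VectorLegVolumeAdapter (MvE)
open Summit.QuantumFields.BalabanUV.Beta.AxialDressingRooted (coDressKBmAt)
open Summit.QuantumFields.BalabanUV.Beta.RowD1JointEnd (JsRowD1 JsRowD1Pin)
open Summit.QuantumFields.BalabanUV.Beta.FP.RoadRowD1 (JsRowD1Undressed)
open Summit.QuantumFields.BalabanUV.Beta.D1BFx.FirstStepPinned (JcPin)
open Summit.QuantumFields.BalabanUV.Beta.HessKerSlotCurrencyRowD1 (d1Drift_JsRowD1_iff_of_halfKernel_letters)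
open Summit.QuantumFields.BalabanUV.Beta.RowD1TelescopingBounded (sdSumBdd_iff_D1Drift_of_D1Rep d1Drift_JsRowD1Pin_of_sdSumBdd_D1Rep
  d1Rep_JcPin_of_D1Drift_sdSumBdd)

namespace Summit.QuantumFields.BalabanUV.Beta.RowD1ThreeRoads

noncomputable section

variable {Lc : ℕ} [NeZero Lc] {L : Type*}

section ThreeRoads

variable (hLc : Odd Lc) (hL2 : 2 ≤ Lc) {N : ℕ} (hN : 2 ≤ N)
  {μ ν : Fin 4} {CW δW cW δW' CS δS cS δS' θ : ℝ}
  -- road A2's four L2 half-kernel letters for the literal of record (HYPOTHESES)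
  (hWu : UniformDecay (fun j => hessKer (coDressKBmAt (toSite (ctrOff (3 + 1) Lc)) Lc (KInvStep (d := 3) Lc j)) 0
    (JsRowD1Undressed hLc N (2 / (Lc : ℝ) ^ 4) (-((Lc : ℝ) ^ 12 / 4)) j).W) μ ν CW δW)
  (hWa : AllScalesRate (fun j => hessKer (coDressKBmAt (toSite (ctrOff (3 + 1) Lc)) Lc (KInvStep (d := 3) Lc j)) 0
    (JsRowD1Undressed hLc N (2 / (Lc : ℝ) ^ 4) (-((Lc : ℝ) ^ 12 / 4)) j).W) μ ν cW δW' θ)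
  (hSu : UniformDecay (fun j => hessKer (coDressKBmAt (toSite (ctrOff (3 + 1) Lc)) Lc (KInvStep (d := 3) Lc j))
    (vertexOfK (coDressKBmAt (toSite (ctrOff (3 + 1) Lc)) Lc (KInvStep (d := 3) Lc j)) Lc
      (JsRowD1Undressed hLc N (2 / (Lc : ℝ) ^ 4) (-((Lc : ℝ) ^ 12 / 4)) j).S) 0) μ ν CS δS)
  (hSa : AllScalesRate (fun j => hessKer (coDressKBmAt (toSite (ctrOff (3 + 1) Lc)) Lc (KInvStep (d := 3) Lc j))
    (vertexOfK (coDressKBmAt (toSite (ctrOff (3 + 1) Lc)) Lc (KInvStep (d := 3) Lc j)) Lc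
      (JsRowD1Undressed hLc N (2 / (Lc : ℝ) ^ 4) (-((Lc : ℝ) ^ 12 / 4)) j).S) 0) μ ν cS δS' θ)
  (hδW : 0 < δW) (hδW' : 0 < δW') (hδS : 0 < δS) (hδS' : 0 < δS') (hθ0 : 0 ≤ θ) (hθ1 : θ < 1)
  -- the free-bubble drift's standing data (printed B5 Props BY NAME, labels, channel, colour, window)
  (a : ℝ) (ha : 0 < a)
  (h12 : B5.Prop12Printed (fam (fun i : ℕ+ × ℕ => ((i.1 : ℕ+) : ℕ)) (fun i => i.1.pos) MvE a ha))
  (h126 : B5.Kernel126_127Printed (kfam (fun i : ℕ+ × ℕ => ((i.1 : ℕ+) : ℕ)) MvE))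
  {SL : Finset L} (hSL : SL.Nonempty) (k : L → Fin 4) (hμν : μ ≠ ν) {Nc : ℝ} (hNc : Nc ≠ 0)
  {cc : ℝ} {M : ℕ → ℕ} (hc : 1 ≤ cc) (hMw : ∀ L : ℕ, 2 ≤ L → 1 ≤ M L ∧ (L : ℝ) ≤ cc * M L) (hML : ∀ L : ℕ, 2 ≤ L → M L ≤ L)

include hWu hWa hSu hSa hδW hδW' hδS hδS' hθ0 hθ1

/-- [folklore] Road A2's socket at the literal of record, read at the pinned constants: GIVEN the four L2 half-kernel letters,
`D1Drift Lc (JsRowD1Pin hLc N) Nc μ ν ↔` the identification (asym1's `d1Drift_JsRowD1_iff_of_halfKernel_letters`; `JsRowD1Pin = JsRowD1 … (2∕Lc⁴) (−Lc¹²∕4)` by `rfl`). -/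
theorem d1Drift_JsRowD1Pin_iff_ident :
    D1Drift Lc (JsRowD1Pin hLc N) Nc μ ν ↔
      secondMoment (limKernelOf fun j => hessKer (coDressKBmAt (toSite (ctrOff (3 + 1) Lc)) Lc (KInvStep (d := 3) Lc j)) 0
          (JsRowD1Undressed hLc N (2 / (Lc : ℝ) ^ 4) (-((Lc : ℝ) ^ 12 / 4)) j).W) μ ν +
        secondMoment (limKernelOf fun j => hessKer (coDressKBmAt (toSite (ctrOff (3 + 1) Lc)) Lc (KInvStep (d := 3) Lc j))
          (vertexOfK (coDressKBmAt (toSite (ctrOff (3 + 1) Lc)) Lc (KInvStep (d := 3) Lc j)) Lc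
            (JsRowD1Undressed hLc N (2 / (Lc : ℝ) ^ 4) (-((Lc : ℝ) ^ 12 / 4)) j).S) 0) μ ν =
        stepBal Nc Lc :=
  d1Drift_JsRowD1_iff_of_halfKernel_letters hLc N (2 / (Lc : ℝ) ^ 4) (-((Lc : ℝ) ^ 12 / 4)) hWu hWa hSu hSa hδW hδW' hδS hδS' hθ0 hθ1 Nc

include hL2 hN ha h12 h126 hSL hμν hNc hc hMw hML

/-- [folklore] **GIVEN `D1Rep(JcPin)` (and road A2's letters + the standing data): (SDF-Σ) ⟺ THE IDENTIFICATION.** -/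
theorem sdSumBdd_iff_ident_of_D1Rep (hrep : D1Rep Lc (JcPin hLc N) Nc μ ν a SL k) :
    (∃ U' : ℝ, ∀ m : ℕ, 1 ≤ m → |∑ j ∈ Ico 1 m, secondMoment (SD Lc (JsRowD1Pin hLc N) (JcPin hLc N) j) μ ν| ≤ U') ↔
      secondMoment (limKernelOf fun j => hessKer (coDressKBmAt (toSite (ctrOff (3 + 1) Lc)) Lc (KInvStep (d := 3) Lc j)) 0
          (JsRowD1Undressed hLc N (2 / (Lc : ℝ) ^ 4) (-((Lc : ℝ) ^ 12 / 4)) j).W) μ ν +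
        secondMoment (limKernelOf fun j => hessKer (coDressKBmAt (toSite (ctrOff (3 + 1) Lc)) Lc (KInvStep (d := 3) Lc j))
          (vertexOfK (coDressKBmAt (toSite (ctrOff (3 + 1) Lc)) Lc (KInvStep (d := 3) Lc j)) Lc
            (JsRowD1Undressed hLc N (2 / (Lc : ℝ) ^ 4) (-((Lc : ℝ) ^ 12 / 4)) j).S) 0) μ ν =
        stepBal Nc Lc :=
  (sdSumBdd_iff_D1Drift_of_D1Rep hLc hL2 hN a ha h12 h126 hSL k hμν hNc hc hMw hML hrep).trans
    (d1Drift_JsRowD1Pin_iff_ident hLc hWu hWa hSu hSa hδW hδW' hδS hδS' hθ0 hθ1)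

/-- [folklore] **(T) ∧ (R) ⟹ (I)**: the telescoping clause and the representation clause give road A2's identification. -/
theorem ident_of_sdSumBdd_D1Rep
    (hSB : ∃ U' : ℝ, ∀ m : ℕ, 1 ≤ m → |∑ j ∈ Ico 1 m, secondMoment (SD Lc (JsRowD1Pin hLc N) (JcPin hLc N) j) μ ν| ≤ U')
    (hrep : D1Rep Lc (JcPin hLc N) Nc μ ν a SL k) :
    secondMoment (limKernelOf fun j => hessKer (coDressKBmAt (toSite (ctrOff (3 + 1) Lc)) Lc (KInvStep (d := 3) Lc j)) 0
        (JsRowD1Undressed hLc N (2 / (Lc : ℝ) ^ 4) (-((Lc : ℝ) ^ 12 / 4)) j).W) μ ν +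
      secondMoment (limKernelOf fun j => hessKer (coDressKBmAt (toSite (ctrOff (3 + 1) Lc)) Lc (KInvStep (d := 3) Lc j))
        (vertexOfK (coDressKBmAt (toSite (ctrOff (3 + 1) Lc)) Lc (KInvStep (d := 3) Lc j)) Lc
          (JsRowD1Undressed hLc N (2 / (Lc : ℝ) ^ 4) (-((Lc : ℝ) ^ 12 / 4)) j).S) 0) μ ν =
      stepBal Nc Lc :=
  (sdSumBdd_iff_ident_of_D1Rep hLc hL2 hN hWu hWa hSu hSa hδW hδW' hδS hδS' hθ0 hθ1 a ha h12 h126 hSL k hμν hNc hc hMw hML hrep).1 hSB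

/-- [folklore] **(I) ∧ (R) ⟹ (T)**: road A2's identification and the representation clause give the telescoping clause. -/
theorem sdSumBdd_of_ident_D1Rep
    (hI : secondMoment (limKernelOf fun j => hessKer (coDressKBmAt (toSite (ctrOff (3 + 1) Lc)) Lc (KInvStep (d := 3) Lc j)) 0
        (JsRowD1Undressed hLc N (2 / (Lc : ℝ) ^ 4) (-((Lc : ℝ) ^ 12 / 4)) j).W) μ ν +
      secondMoment (limKernelOf fun j => hessKer (coDressKBmAt (toSite (ctrOff (3 + 1) Lc)) Lc (KInvStep (d := 3) Lc j))
        (vertexOfK (coDressKBmAt (toSite (ctrOff (3 + 1) Lc)) Lc (KInvStep (d := 3) Lc j)) Lc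
          (JsRowD1Undressed hLc N (2 / (Lc : ℝ) ^ 4) (-((Lc : ℝ) ^ 12 / 4)) j).S) 0) μ ν =
      stepBal Nc Lc)
    (hrep : D1Rep Lc (JcPin hLc N) Nc μ ν a SL k) :
    ∃ U' : ℝ, ∀ m : ℕ, 1 ≤ m → |∑ j ∈ Ico 1 m, secondMoment (SD Lc (JsRowD1Pin hLc N) (JcPin hLc N) j) μ ν| ≤ U' :=
  (sdSumBdd_iff_ident_of_D1Rep hLc hL2 hN hWu hWa hSu hSa hδW hδW' hδS hδS' hθ0 hθ1 a ha h12 h126 hSL k hμν hNc hc hMw hML hrep).2 hI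

/-- [folklore] **(I) ∧ (T) ⟹ (R)**: road A2's identification and the telescoping clause give the representation clause `D1Rep(JcPin)`. -/
theorem d1Rep_of_ident_sdSumBdd
    (hI : secondMoment (limKernelOf fun j => hessKer (coDressKBmAt (toSite (ctrOff (3 + 1) Lc)) Lc (KInvStep (d := 3) Lc j)) 0
        (JsRowD1Undressed hLc N (2 / (Lc : ℝ) ^ 4) (-((Lc : ℝ) ^ 12 / 4)) j).W) μ ν +
      secondMoment (limKernelOf fun j => hessKer (coDressKBmAt (toSite (ctrOff (3 + 1) Lc)) Lc (KInvStep (d := 3) Lc j))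
        (vertexOfK (coDressKBmAt (toSite (ctrOff (3 + 1) Lc)) Lc (KInvStep (d := 3) Lc j)) Lc
          (JsRowD1Undressed hLc N (2 / (Lc : ℝ) ^ 4) (-((Lc : ℝ) ^ 12 / 4)) j).S) 0) μ ν =
      stepBal Nc Lc)
    (hSB : ∃ U' : ℝ, ∀ m : ℕ, 1 ≤ m → |∑ j ∈ Ico 1 m, secondMoment (SD Lc (JsRowD1Pin hLc N) (JcPin hLc N) j) μ ν| ≤ U') :
    D1Rep Lc (JcPin hLc N) Nc μ ν a SL k :=
  d1Rep_JcPin_of_D1Drift_sdSumBdd hLc hL2 hN a ha h12 h126 hSL k hμν hNc hc hMw hML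
    ((d1Drift_JsRowD1Pin_iff_ident hLc hWu hWa hSu hSa hδW hδW' hδS hδS' hθ0 hθ1).2 hI) hSB

end ThreeRoads

end

end Summit.QuantumFields.BalabanUV.Beta.RowD1ThreeRoads
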